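import Summits.AtomisticToContinuum.HydrodynamicLimit.Theorems.LambertianContactSwapLambertianEulerMarkedKorolyuk
import Summits.AtomisticToContinuum.HydrodynamicLimit.Theorems.LambertianContactSwapLambertianEulerSimpleCollisions
import HarnessLib

/-!
# Cellwise fresh / non-fresh charging of the Lambertian collision sequence: cells and free flights
# (`LambertianContactSwap.LambertianEuler`, stmt-AtomisticToContinuum-11854, line `Sketch`; lead c10,
# piece W7 `CellCharging`, part 2 of 4: registered helper stub `exit_apply_of_free`)

Pathwise tools for `…CellCharging.windowCount_le_cellShells_add_marks`.  Notation (as in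
`…MarkedKorolyuk`): `t_k = lambertInstant`, `z_k = lambertStateAfter`, `τ_k = freeExitTime z_k`,
`z_k♭ = S_{τ_k} z_k` the exit configuration of collision number `k + 1` (time `t_{k+1}`), `p_k` its
incoming pair, `z_{k+1} = lambertPair p_k z_k♭ (ξs k)`.

* `cell_bounds`, `cell_eq_of_mem`: the cell `⌈(t - a')/δ⌉ - 1` of an instant `t ∈ (a', a' + Jδ]`.
* `toReal_lambertInstant_succ`: `t_{k+1} = t_k + τ_k` in `ℝ` below a finite instant.
* `exit_apply_of_free` (FLIGHT LEMMA, registered): a particle taking part in no collision `n`,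
  `k ≤ n < m`, sits in `z_m♭` at `(x + (t_{m+1} - t_k) v, v)`, `(x, v) = z_k a`
  (`lambertPair_apply_of_ne`, `freeFlight_apply`, `Geometry.translate_add`).
* `norm_sepVec_exit_le_of_free`: two particles that collided at `m'`, free since, are in `z_m♭` at
  separation `≤ ε + |t_{m+1} - t_{m'+1}| ‖Δv‖` (Lipschitz separation along translations).
* `le_mul_norm_of_recollision`: if moreover they collide again at `m` within time `≤ δ`, the "no fast
  re-collision" hypothesis (threshold `L`; on `𝕋³`
  `…TorusNoFastRecollision.one_sub_two_mul_le_mul_norm_of_recontact`) gives `L ≤ δ ‖Δv‖` — at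
  `z_{m'+1}` the pair is at contact and not incoming (`not_isIncoming_lambertPair`), at `z_m♭` at
  contact and incoming.

References: Cercignani–Illner–Pulvirenti, *The Mathematical Theory of Dilute Gases* (1994), App. 4.A;
Gallagher–Saint-Raymond–Texier 2013, Ch. 4.  All statements [folklore].
-/

noncomputable section

namespace Summit.AtomisticToContinuum.HydrodynamicLimit.Theorems.LambertianContactSwapLambertianEulerCellChargingFlight

open scoped BigOperators Topology ENNReal InnerProductSpace
open MeasureTheory Filter Set
open Literature.MathematicalPhysics.KineticTheory
open Literature.Analysis.FluidPDE Literature.Analysis.FluidPDE.Alexander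

/-! ## Cell arithmetic -/

/-- **The cell of an instant.**  For `δ > 0` and `a' < t ≤ a' + J δ`, the cell index
`c = ⌈(t - a')/δ⌉₊ - 1` satisfies `c < J` and `a' + c δ < t ≤ a' + c δ + δ`. [folklore] -/
theorem cell_bounds {a' δ t : ℝ} {J : ℕ} (hδ : 0 < δ) (hat : a' < t) (htJ : t ≤ a' + (J : ℝ) * δ) :
    ⌈(t - a') / δ⌉₊ - 1 < J ∧ a' + ((⌈(t - a') / δ⌉₊ - 1 : ℕ) : ℝ) * δ < t ∧
      t ≤ a' + ((⌈(t - a') / δ⌉₊ - 1 : ℕ) : ℝ) * δ + δ := by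
  have hx : 0 < (t - a') / δ := div_pos (sub_pos.2 hat) hδ
  have hJ1 : ⌈(t - a') / δ⌉₊ - 1 + 1 = ⌈(t - a') / δ⌉₊ := Nat.sub_add_cancel (Nat.ceil_pos.2 hx)
  have hJcast : ((⌈(t - a') / δ⌉₊ - 1 : ℕ) : ℝ) + 1 = (⌈(t - a') / δ⌉₊ : ℝ) := mod_cast hJ1
  refine ⟨?_, ?_, ?_⟩
  · have hceil : ⌈(t - a') / δ⌉₊ ≤ J := by
      refine Nat.ceil_le.2 ((div_le_iff₀ hδ).2 ?_)
      linarith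
    omega
  · have h1 : (⌈(t - a') / δ⌉₊ : ℝ) < (t - a') / δ + 1 := Nat.ceil_lt_add_one hx.le
    rw [← hJcast] at h1
    have h2 : ((⌈(t - a') / δ⌉₊ - 1 : ℕ) : ℝ) < (t - a') / δ := by linarith
    rw [lt_div_iff₀ hδ] at h2
    linarith
  · have h1 : (t - a') / δ ≤ (⌈(t - a') / δ⌉₊ : ℝ) := Nat.le_ceil _
    rw [← hJcast, div_le_iff₀ hδ] at h1
    linarith

/-- **Instants of one cell have the same cell index**: if `a' + c δ < t ≤ a' + c δ + δ` then
`⌈(t - a')/δ⌉₊ - 1 = c`. [folklore] -/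
theorem cell_eq_of_mem {a' δ t : ℝ} {c : ℕ} (hδ : 0 < δ) (h1 : a' + (c : ℝ) * δ < t)
    (h2 : t ≤ a' + (c : ℝ) * δ + δ) : ⌈(t - a') / δ⌉₊ - 1 = c := by
  have hceil : ⌈(t - a') / δ⌉₊ = c + 1 := by
    rw [Nat.ceil_eq_iff (Nat.add_one_ne_zero c), Nat.add_sub_cancel]
    constructor
    · rw [lt_div_iff₀ hδ]
      linarith
    · rw [div_le_iff₀ hδ]
      push_cast
      linarith
  omega

/-! ## Pathwise flights of the Lambertian recursion -/

section Pathwise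

variable {d : Type*} [Fintype d] {X : Type*} {N : ℕ} {G : Geometry d X} {ε : ℝ}
  {ξs : ℕ → EuclideanSpace ℝ d} {z : Config N d X}

/-- Below a finite instant `t_K` the instants are real numbers with `t_{k+1} = t_k + τ_k`, `τ_k`
finite (`k < K`). [folklore] -/
theorem toReal_lambertInstant_succ {K k : ℕ} (htop : lambertInstant G ε ξs z K ≠ ∞) (hk : k < K) :
    (lambertInstant G ε ξs z (k + 1)).toReal = (lambertInstant G ε ξs z k).toReal +
        (freeExitTime G ε (lambertStateAfter G ε ξs z k)).toReal ∧
      freeExitTime G ε (lambertStateAfter G ε ξs z k) ≠ ∞ := by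
  have h1 : lambertInstant G ε ξs z (k + 1) ≠ ∞ :=
    ne_top_of_le_ne_top htop (monotone_lambertInstant ξs z (Nat.succ_le_of_lt hk))
  have hk' : lambertInstant G ε ξs z k ≠ ∞ :=
    ne_top_of_le_ne_top htop (monotone_lambertInstant ξs z hk.le)
  rw [lambertInstant_succ] at h1 ⊢
  exact ⟨ENNReal.toReal_add hk' (ENNReal.add_ne_top.1 h1).2, (ENNReal.add_ne_top.1 h1).2⟩

/-- **Flight lemma** (registered helper stub of lead c10's piece W7, part 2).  Write `t k` for the
real instants and `E k = z_k♭` for the exit configurations, and let the recursion redraw the pair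
`p k` at each collision `k < K` (`z_{k+1} = lambertPair (p k) z_k♭ (ξs k)`, `t_K < ∞`).  If particle
`a` takes part in no collision `n` with `k ≤ n < m` (`m < K`), then in `z_m♭` it sits at
`(x + (t_{m+1} - t_k) • v, v)` where `(x, v) = z_k a`: it flew freely since time `t_k`
(`lambertPair_apply_of_ne`, `freeFlight_apply`, `Geometry.translate_add`). [folklore] -/
theorem exit_apply_of_free :
    ∀ {d : Type*} [Fintype d] {X : Type*} {N : ℕ} {G : Geometry d X} {ε : ℝ}
      {ξs : ℕ → EuclideanSpace ℝ d} {z : Config N d X} {K : ℕ} {t : ℕ → ℝ} {E : ℕ → Config N d X}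
      {p : ℕ → Fin N × Fin N},
      (∀ k, t k = (lambertInstant G ε ξs z k).toReal) →
      (∀ k, E k = freeFlight G (freeExitTime G ε (lambertStateAfter G ε ξs z k)).toReal
        (lambertStateAfter G ε ξs z k)) →
      lambertInstant G ε ξs z K ≠ ⊤ →
      (∀ k < K, lambertStateAfter G ε ξs z (k + 1) = lambertPair G (p k).1 (p k).2 (E k) (ξs k)) →
      ∀ {a : Fin N} {k m : ℕ}, k ≤ m → m < K →
        (∀ n, k ≤ n → n < m → a ≠ (p n).1 ∧ a ≠ (p n).2) →
        E m a = (G.translate (lambertStateAfter G ε ξs z k a).1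
            ((t (m + 1) - t k) • (lambertStateAfter G ε ξs z k a).2),
          (lambertStateAfter G ε ξs z k a).2) := by
  intro d _ X N G ε ξs z K t E p ht hE htop hstep a k m hkm hmK hfree
  obtain ⟨n, rfl⟩ := Nat.exists_eq_add_of_le hkm
  induction n with
  | zero =>
    rw [Nat.add_zero] at hmK ⊢
    obtain ⟨hgap, -⟩ := toReal_lambertInstant_succ htop hmK
    rw [hE, freeFlight_apply, ht, ht, hgap, add_sub_cancel_left]
  | succ n ih =>
    have hmK' : k + n < K := by omega
    have hmK2 : k + n + 1 < K := by omega
    have ih' := ih (by omega) hmK' fun n' h1 h2 => hfree n' h1 (by omega)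
    obtain ⟨ha1, ha2⟩ := hfree (k + n) (by omega) (by omega)
    have hgap : t (k + n + 1 + 1) = t (k + n + 1) +
        (freeExitTime G ε (lambertStateAfter G ε ξs z (k + n + 1))).toReal := by
      rw [ht, ht]
      exact (toReal_lambertInstant_succ htop hmK2).1
    have hz : lambertStateAfter G ε ξs z (k + n + 1) a = E (k + n) a := by
      rw [hstep (k + n) hmK', lambertPair_apply_of_ne ha1 ha2]
    have hc : t (k + n + 1) - t k +
        (freeExitTime G ε (lambertStateAfter G ε ξs z (k + n + 1))).toReal =
        t (k + n + 1 + 1) - t k := by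
      rw [hgap]
      ring
    rw [← add_assoc, hE, freeFlight_apply, hz, ih']
    simp only [Geometry.translate_add, ← add_smul]
    rw [hc]

/-- **Two particles free since their collision stay close.**  If `{a, b}` is the colliding pair
of collision `m'` and neither takes part in a collision strictly between `m'` and `m` (`m' < m < K`),
then in `z_m♭` their separation is at most `ε + |t_{m+1} - t_{m'+1}| ‖v_a - v_b‖`: at `z_{m'+1}` they
are at contact (`lambertPair` does not move particles), then both fly freely (`exit_apply_of_free`)
and the separation is Lipschitz along translations. [folklore] -/
theorem norm_sepVec_exit_le_of_free {K : ℕ} {t : ℕ → ℝ} {E : ℕ → Config N d X}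
    {p : ℕ → Fin N × Fin N}
    (hLipB : ∀ (x y : X) (vx vy : EuclideanSpace ℝ d) (u : ℝ),
      ‖G.sepVec (G.translate x (u • vx)) (G.translate y (u • vy))‖ ≤ ‖G.sepVec x y‖ + |u| * ‖vx - vy‖)
    (hsymm : ∀ x y : X, ‖G.sepVec x y‖ = ‖G.sepVec y x‖)
    (ht : ∀ k, t k = (lambertInstant G ε ξs z k).toReal)
    (hE : ∀ k, E k = freeFlight G (freeExitTime G ε (lambertStateAfter G ε ξs z k)).toReal
      (lambertStateAfter G ε ξs z k))
    (htop : lambertInstant G ε ξs z K ≠ ∞)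
    (hstep : ∀ k < K, lambertStateAfter G ε ξs z (k + 1) = lambertPair G (p k).1 (p k).2 (E k) (ξs k))
    (hp : ∀ k < K, IsSimpleIncomingWith G ε (E k) (p k))
    {a b : Fin N} {m' m : ℕ} (hm'm : m' < m) (hmK : m < K)
    (hab : a = (p m').1 ∧ b = (p m').2 ∨ a = (p m').2 ∧ b = (p m').1)
    (hfa : ∀ n, m' < n → n < m → a ≠ (p n).1 ∧ a ≠ (p n).2)
    (hfb : ∀ n, m' < n → n < m → b ≠ (p n).1 ∧ b ≠ (p n).2) :
    ‖G.sepVec (E m a).1 (E m b).1‖ ≤ ε + |t (m + 1) - t (m' + 1)| * ‖(E m a).2 - (E m b).2‖ := by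
  have hm'K : m' < K := hm'm.trans hmK
  -- contact at `z_{m'+1}`
  have hc : ‖G.sepVec (lambertStateAfter G ε ξs z (m' + 1) a).1
      (lambertStateAfter G ε ξs z (m' + 1) b).1‖ = ε := by
    rw [hstep m' hm'K, lambertPair_apply_fst, lambertPair_apply_fst]
    have h := (hp m' hm'K).mem_contactSet.2
    rcases hab with ⟨rfl, rfl⟩ | ⟨rfl, rfl⟩
    · exact h
    · rw [hsymm]; exact h
  rw [exit_apply_of_free ht hE htop hstep (Nat.succ_le_of_lt hm'm) hmK hfa,
    exit_apply_of_free ht hE htop hstep (Nat.succ_le_of_lt hm'm) hmK hfb]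
  calc _ ≤ ‖G.sepVec (lambertStateAfter G ε ξs z (m' + 1) a).1
        (lambertStateAfter G ε ξs z (m' + 1) b).1‖ + |t (m + 1) - t (m' + 1)| *
        ‖(lambertStateAfter G ε ξs z (m' + 1) a).2 - (lambertStateAfter G ε ξs z (m' + 1) b).2‖ :=
      hLipB _ _ _ _ _
    _ = _ := by rw [hc]

/-- **A re-collision of the same pair within time `δ` is fast.**  If the colliding pair of `m` is
the colliding pair of `m' < m` and both particles are free strictly between, with
`0 < t_{m+1} - t_{m'+1} ≤ δ`, then the "no fast re-collision below `L`" hypothesis (from contact and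
not incoming — `not_isIncoming_lambertPair` at `z_{m'+1}` — a free flight of duration `u ∈ (0, δ]`
to contact and incoming forces `L ≤ δ ‖Δv‖`) gives `L ≤ δ ‖v_{p_m.1} - v_{p_m.2}‖` at `z_m♭`.
[folklore] -/
theorem le_mul_norm_of_recollision {K : ℕ} {t : ℕ → ℝ} {E : ℕ → Config N d X}
    {p : ℕ → Fin N × Fin N} {δ L : ℝ}
    (hL : ∀ (x y : X) (vx vy : EuclideanSpace ℝ d) (u : ℝ), 0 < u → u ≤ δ → ‖G.sepVec x y‖ = ε →
      0 ≤ ⟪G.sepVec x y, vx - vy⟫_ℝ →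
      ‖G.sepVec (G.translate x (u • vx)) (G.translate y (u • vy))‖ = ε →
      ⟪G.sepVec (G.translate x (u • vx)) (G.translate y (u • vy)), vx - vy⟫_ℝ < 0 →
      L ≤ δ * ‖vx - vy‖)
    (ht : ∀ k, t k = (lambertInstant G ε ξs z k).toReal)
    (hE : ∀ k, E k = freeFlight G (freeExitTime G ε (lambertStateAfter G ε ξs z k)).toReal
      (lambertStateAfter G ε ξs z k))
    (htop : lambertInstant G ε ξs z K ≠ ∞)
    (hstep : ∀ k < K, lambertStateAfter G ε ξs z (k + 1) = lambertPair G (p k).1 (p k).2 (E k) (ξs k))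
    (hp : ∀ k < K, IsSimpleIncomingWith G ε (E k) (p k))
    {m' m : ℕ} (hm'm : m' < m) (hmK : m < K) (hpm : p m = p m')
    (hu0 : 0 < t (m + 1) - t (m' + 1)) (huδ : t (m + 1) - t (m' + 1) ≤ δ)
    (hf1 : ∀ n, m' < n → n < m → (p m).1 ≠ (p n).1 ∧ (p m).1 ≠ (p n).2)
    (hf2 : ∀ n, m' < n → n < m → (p m).2 ≠ (p n).1 ∧ (p m).2 ≠ (p n).2) :
    L ≤ δ * ‖(E m (p m).1).2 - (E m (p m).2).2‖ := by
  have hm'K : m' < K := hm'm.trans hmK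
  have hcont := (hp m hmK).mem_contactSet.2
  have hin := (hp m hmK).isIncoming
  unfold IsIncoming at hin
  rw [exit_apply_of_free ht hE htop hstep (Nat.succ_le_of_lt hm'm) hmK hf1,
    exit_apply_of_free ht hE htop hstep (Nat.succ_le_of_lt hm'm) hmK hf2] at hcont hin ⊢
  refine hL _ _ _ _ _ hu0 huδ ?_ ?_ hcont hin
  · -- contact at `z_{m'+1}`
    rw [hstep m' hm'K, lambertPair_apply_fst, lambertPair_apply_fst, hpm]
    exact (hp m' hm'K).mem_contactSet.2
  · -- not incoming at `z_{m'+1}`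
    have h := LambertianContactSwapLambertianEulerSimpleCollisions.not_isIncoming_lambertPair (G := G)
      (hp m' hm'K).ne (E m') (ξs m')
    rw [← hstep m' hm'K, ← hpm] at h
    unfold IsIncoming at h
    exact not_lt.1 h

end Pathwise

end Summit.AtomisticToContinuum.HydrodynamicLimit.Theorems.LambertianContactSwapLambertianEulerCellChargingFlight

end
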